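import Summits.BirchSwinnertonDyer.BirchSwinnertonDyer.Theorems.AlignedTransportAtTwoMainConjectureOfRankZeroBSDAtTwoHalfDescentLayerIndexGrowthSelmer
import Summits.BirchSwinnertonDyer.BirchSwinnertonDyer.Theorems.AlignedTransportAtTwoMainConjectureOfRankZeroBSDAtTwoSeed
import HarnessLib

/-!
# Route `AlignedTransportAtTwo`, crux C2 `MainConjectureOfRankZeroBSDAtTwo` (stmt-BirchSwinnertonDyer-22298):
# THE GROWTH NUMBER WITHOUT GREENBERG 4.14, IV — THE SEED FED BY ONE STEP OF SUB-MAXIMAL GROWTH (`p = 2`): PRINT + `BSD(W,2)` +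
# `0 < #Sel_{2^∞}(W/ℚ_∞)^{Γ_{n+1}} < 2^{2ⁿ} · #Sel_{2^∞}(W/ℚ_∞)^{Γ_n}` at ANY ONE layer for every cyclotomic datum ⟹ Mazur's `2`-adic main conjecture for `W`;
# the crux statement C2 BY NAME from PRINT + that certificate on the seed cell; the finite-level form with two consecutive layers

HONEST FRAMING (cell `bsd-f1-sign2`, WIDTH-5 attached prover seat `bsd-line-att-p5` gen 56 on line `birth` of the lead `bsd-line-att-p2`;
`--supports` stmt-BirchSwinnertonDyer-22298, closes nothing; BSD is NOT proved by any of this; the crux C2, its verdict «blocked-on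
`Rank1Residual.GreenbergMuConjectureIrreducible`» and every registered stub (P / T / Kμ / LimDoor / MuIneqʳ / PFμ⁺) are untouched). THEOREMS ONLY — no `def`,
no instance, no `sorry`; the PRINT binders are exactly the seed's (`h17` Kato 17.4 (1)(2) at `2`, `hGr` Greenberg 4.1, `hper` period unit, `hmod` modularity,
`hGZK` Gross–Zagier–Kolyvagin), displayed. Sequel of this gen's route-independent `…HalfDescentLayerIndexGrowthSelmer` (for EVERY dual datum with `X` f.g. torsion:
`0 < #Sel_∞^{Γ_{n+1}} < p^{pⁿ(p−1)}·#Sel_∞^{Γ_n}` at ANY ONE `n` ⟹ `μ(X) = 0`, and its finite-level form) composed with the lead's seed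
`…Seed.mazurMainConjecture_two_of_bsdp_of_mu_eq_zero` (p583329: PRINT + `BSD(W,2)` + `μ₂(X) = 0` for every cyclotomic datum ⟹ `MazurMainConjecture W 2`).
This file lives in the route's import cone on purpose (it names the crux); the route-independent mathematics is in files I–III. Cf. gen 55's
`…HalfDescentLayerIndexCertificateSeed` (certificates `#ker N_n < 2^{2ⁿ}`, `#Sel_∞^{Γ_{n+1}} < 2^{2ⁿ}`, `#Sel_{n+1}·#ker g_{n+1} < 2^{2ⁿ}`): each of those implies
the RATIO certificate used here, which is therefore the weakest sufficient one-layer inequality of the lineage.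

WHAT THIS BUYS FOR C2. The `μ`-residue of C2 — the ONLY non-print input of the seed (lead g0–g6: «C2 ⟺ stub T mod PRINT») — follows from ONE STEP of the cyclotomic
`ℤ₂`-tower at which the `Γ`-invariants of `Sel_{2^∞}(W/ℚ_∞)` grow by LESS than the maximal factor `2^{2ⁿ}`: **`0 < #Sel_∞^{Γ_{n+1}} < 2^{2ⁿ} · #Sel_∞^{Γ_n}`** for
some `n`, for every cyclotomic `(κ, γ)` (no Greenberg 4.14, no `λ_an`, no `G`, no exact count; complete in the rank-`0` tower by file III). For the lineage's anchors
(`λ_an = 2`, MC expected) the step factor is `4` from `n = 1` on, so the step `n = 2` (`4 < 16`) is the first eligible one — a certificate SHAPE, not a computation.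

* ★★★ **`mazurMainConjecture_two_of_bsdp_of_natCard_selmerInvariants_succ_lt_mul`**: PRINT + good ordinary at `2` + no rational `2`-torsion + `r_an = 0` +
  `BSD(W,2)` + (for every cyclotomic `(κ,γ)` some `n` with `0 < #Sel_∞^{Γ_{n+1}} < 2^{2ⁿ}·#Sel_∞^{Γ_n}`) ⟹ **`MazurMainConjecture W 2`**;
* ★★★ **`mainConjectureOfRankZeroBSDAtTwo_of_natCard_selmerInvariants_succ_lt_mul`**: PRINT + that certificate on every seed-cell curve ⟹ the crux statement
  `MainConjectureOfRankZeroBSDAtTwo` BY NAME (CONDITIONAL; credits nothing);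
* ★★ finite level: **`mazurMainConjecture_two_of_bsdp_of_natCard_selmerLayer_succ_mul_lt_mul`** / **`mainConjectureOfRankZeroBSDAtTwo_of_natCard_selmerLayer_succ_mul_lt_mul`**
  with the certificate **`0 < #Sel_{2^∞}(W/ℚ_{n+1})·#ker g_{n+1}` and `#Sel_{2^∞}(W/ℚ_{n+1})·#ker g_{n+1}·#ker h_n < 2^{2ⁿ}·#Sel_{2^∞}(W/ℚ_n)·#ker g_n`** at some `n`
  (`ℚ_m = ℚ(ζ_{2^{m+2}})⁺`; `ker g_m` Greenberg's control kernel, `ker h_m` the kernel of `Sel_m → Sel_∞^{Γ_m}`).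
Memo `Cruxes/MainConjectureOfRankZeroBSDAtTwo/LAYER-GROWTH-att-p5-g56.md`. BSD is not proved by any of this; no certificate is computed here for any curve.

References: R. Greenberg, LNM 1716 (1999), §1 pp. 60–65, Conj. 1.11, Thm. 4.1, §4 Lemma 4.3 [GreenbergLNM1716]; K. Kato, Astérisque 295 (2004) Thm. 17.4
[Kato2004Asterisque]; L. Washington, GTM 83, §13.3 Thm. 13.13 [Washington1997]; R. L. Miller, LMS J. Comput. Math. 14 (2011) Def. 1.1 [Miller2011LMS].
-/

set_option linter.dupNamespace false
set_option autoImplicit false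

noncomputable section

open scoped Classical AddSubgroup MatrixGroups ModularForm Polynomial

namespace Summit.BirchSwinnertonDyer.BirchSwinnertonDyer.Theorems.AlignedTransportAtTwoHalfDescentLayerIndexGrowthSeed

open CongruenceSubgroup WeierstrassCurve Literature.NumberTheory.EllipticCurves Literature.NumberTheory.EllipticCurves.IwasawaDual
  Literature.NumberTheory.EllipticCurves.IwasawaAlgebra
  Literature.NumberTheory.EllipticCurves.ModularForms
  Literature.NumberTheory.EllipticCurves.Rank1Residual
  Literature.NumberTheory.EllipticCurves.Rank1Residual.Typed
  Literature.NumberTheory.EllipticCurves.Greenberg1999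
  Summit.BirchSwinnertonDyer.Rank1Residual
  Summit.BirchSwinnertonDyer.Rank1Residual.X1.MuLambda
  Summit.BirchSwinnertonDyer.Rank1Residual.F1Sign2
  Summit.BirchSwinnertonDyer.Rank1Residual.Iwasawa
  Summit.BirchSwinnertonDyer.BirchSwinnertonDyer.Theorems.Rank1ResidualX1Defs
  Summit.BirchSwinnertonDyer.BirchSwinnertonDyer.Theses.AlignedTransportAtTwo
  Summit.BirchSwinnertonDyer.BirchSwinnertonDyer.Theorems.AlignedTransportAtTwoSeed
  Summit.BirchSwinnertonDyer.BirchSwinnertonDyer.Theorems.AlignedTransportAtTwoHalfDescentLayerIndexGrowthSelmer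

/-! ## §1 `p = 2`: the seed of line `birth` fed by the ratio certificate -/

section Two

variable (W : WeierstrassCurve ℚ) [W.IsElliptic] [W.IsGloballyMinimal]

/-- ★★★ **MAZUR'S `2`-ADIC MAIN CONJECTURE FROM `BSD(W,2)` AND ONE STEP OF SUB-MAXIMAL GROWTH PER CYCLOTOMIC DATUM.** `W/ℚ` elliptic, globally minimal, good ordinary
at `2`, no rational point of order `2`, `r_an = 0`, `BSD(W,2)`; PRINT: Kato 17.4 (1)(2) at `2` (`h17`), Greenberg 4.1 (`hGr`), the period unit (`hper`), modularity (`hmod`),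
GZK (`hGZK`). CERTIFICATE (displayed, per curve): for every cyclotomic `(κ, γ)` there is a layer `n` with
**`0 < #Sel_{2^∞}(W/ℚ_∞)^{Γ_{n+1}} < 2^{2ⁿ} · #Sel_{2^∞}(W/ℚ_∞)^{Γ_n}`**. Then **`MazurMainConjecture W 2`**. [cite: Kato2004Asterisque, Thm. 17.4 (1)(2) (p. 273)]
[cite: GreenbergLNM1716, Thm. 4.1 (p. 102), Thm. 1.10 and Conj. 1.11] [cite: Miller2011LMS, Def. 1.1] -/
theorem mazurMainConjecture_two_of_bsdp_of_natCard_selmerInvariants_succ_lt_mul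
    (h17 : ∀ [NeZero (W.conductorNorm ℤ)] (f : CuspForm (Gamma0 (W.conductorNorm ℤ)) 2), kato_divisibility_allPrimes W 2 (f := f))
    (hGr : Greenberg1999.thm41_charValue_rankZero_anyPrime)
    (hper : realPeriodRat_eq_unit_mul_plusPeriod_two) (hmod : nonempty_modularParametrizationData)
    (hGZK : rank_eq_analyticRank_of_analyticRank_le_one) (hord : IsOrdinaryAt W 2)
    (ht : ∀ x : ℚ, ¬ HasRationalTwoTorsionX W x) (hr : W.analyticRank = 0) (hbsd : BSDp W 2)
    (hcert : ∀ (κ : ZpExtension ℚ 2) (γ : Field.absoluteGaloisGroup ℚ), κ.IsCyclotomic → κ.IsTopGenerator γ → IsCyclotomicVariable 2 γ →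
      ∃ n : ℕ, 0 < Nat.card ↥(W.selmerInfty κ ⊓ W.layerInvariants κ (n + 1)) ∧
        Nat.card ↥(W.selmerInfty κ ⊓ W.layerInvariants κ (n + 1)) < 2 ^ (2 ^ n) * Nat.card ↥(W.selmerInfty κ ⊓ W.layerInvariants κ n)) :
    MazurMainConjecture W 2 := by
  refine AlignedTransportAtTwoSeed.mazurMainConjecture_two_of_bsdp_of_mu_eq_zero W h17 hGr hper hmod hGZK hord ht hr hbsd ?_
  intro κ γ hκ hγ hγ' D hD
  haveI : Module.Finite (IwasawaAlgebra 2) D.X := D.module_finite_holds hγ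
  obtain ⟨n, hpos, hlt⟩ := hcert κ γ hκ hγ hγ'
  have hlt' : Nat.card ↥(W.selmerInfty κ ⊓ W.layerInvariants κ (n + 1)) < 2 ^ (2 ^ n * (2 - 1)) * Nat.card ↥(W.selmerInfty κ ⊓ W.layerInvariants κ n) := by
    rw [show (2:ℕ) - 1 = 1 from rfl, mul_one]; exact hlt
  exact mu_eq_zero_of_natCard_selmerInvariants_succ_pos_lt_mul W κ hγ D hD hpos hlt'

end Two

/-! ## §2 The crux by name from PRINT + the ratio certificate on the seed cell -/

section Crux

/-- ★★★ **C2 FROM PRINT + ONE STEP OF SUB-MAXIMAL GROWTH PER SEED CURVE.** PRINT (`h17` for every curve, `hGr`, `hper`, `hmod`, `hGZK`) and, for every seed-cell curve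
`W` (elliptic, globally minimal, non-CM, good ordinary at `2`, no rational `2`-torsion, `Δ ∉ ℚ²`, `r_an = 0`) and every cyclotomic `(κ, γ)`, SOME layer `n` with
**`0 < #Sel_{2^∞}(W/ℚ_∞)^{Γ_{n+1}} < 2^{2ⁿ} · #Sel_{2^∞}(W/ℚ_∞)^{Γ_n}`** ⟹ the crux statement **`MainConjectureOfRankZeroBSDAtTwo`** by name. Compared with the lead's
`…Seed.mainConjectureOfRankZeroBSDAtTwo_of_seedMuZero` the non-print input «`∀ D, D.mu = 0`» is replaced by a displayed, per-curve inequality between TWO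
consecutive invariant orders; the analytic `μ₂ = 0` hypothesis and `BSD(W,2)` of C2 are consumed by the seed. CONDITIONAL result: the item stays open.
[cite: Kato2004Asterisque, Thm. 17.4 (1)(2) (p. 273)] [cite: GreenbergLNM1716, Thm. 4.1 (p. 102), §1 Conj. 1.11 (p. 58)] -/
theorem mainConjectureOfRankZeroBSDAtTwo_of_natCard_selmerInvariants_succ_lt_mul
    (h17 : ∀ (V : WeierstrassCurve ℚ) [V.IsElliptic] [V.IsGloballyMinimal] [NeZero (V.conductorNorm ℤ)]
      (f : CuspForm (Gamma0 (V.conductorNorm ℤ)) 2), kato_divisibility_allPrimes V 2 (f := f))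
    (hGr : Greenberg1999.thm41_charValue_rankZero_anyPrime)
    (hper : realPeriodRat_eq_unit_mul_plusPeriod_two) (hmod : nonempty_modularParametrizationData)
    (hGZK : rank_eq_analyticRank_of_analyticRank_le_one)
    (hcert : ∀ (W : WeierstrassCurve ℚ) [W.IsElliptic] [W.IsGloballyMinimal], ¬ W.HasCM →
      IsOrdinaryAt W 2 → (∀ x : ℚ, ¬ HasRationalTwoTorsionX W x) → ¬ IsSquare W.Δ → W.analyticRank = 0 →
      ∀ (κ : ZpExtension ℚ 2) (γ : Field.absoluteGaloisGroup ℚ), κ.IsCyclotomic → κ.IsTopGenerator γ → IsCyclotomicVariable 2 γ →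
        ∃ n : ℕ, 0 < Nat.card ↥(W.selmerInfty κ ⊓ W.layerInvariants κ (n + 1)) ∧
          Nat.card ↥(W.selmerInfty κ ⊓ W.layerInvariants κ (n + 1)) < 2 ^ (2 ^ n) * Nat.card ↥(W.selmerInfty κ ⊓ W.layerInvariants κ n)) :
    MainConjectureOfRankZeroBSDAtTwo := by
  intro W _ _ hcm hord ht hsq hr _hμan hbsd
  exact mazurMainConjecture_two_of_bsdp_of_natCard_selmerInvariants_succ_lt_mul W (fun f => h17 W f) hGr hper hmod hGZK hord ht hr hbsd
    (hcert W hcm hord ht hsq hr)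

end Crux

/-! ## §3 Finite level: two consecutive layers of finite-level orders -/

section Finite

variable (W : WeierstrassCurve ℚ) [W.IsElliptic] [W.IsGloballyMinimal]

/-- ★★ **MAZUR'S `2`-ADIC MAIN CONJECTURE FROM `BSD(W,2)` AND FINITE-LEVEL ORDERS AT TWO CONSECUTIVE LAYERS.** As in §1, with the certificate: for every cyclotomic
`(κ, γ)` some `n` with **`0 < #Sel_{2^∞}(W/ℚ_{n+1})·#ker g_{n+1}`** and **`#Sel_{2^∞}(W/ℚ_{n+1})·#ker g_{n+1}·#ker h_n < 2^{2ⁿ}·#Sel_{2^∞}(W/ℚ_n)·#ker g_n`**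
(`ℚ_m = ℚ(ζ_{2^{m+2}})⁺`, `ker g_m = A_m/Sel_m` Greenberg's control kernel, `ker h_m` the kernel of `Sel_m → Sel_∞^{Γ_m}`). Then **`MazurMainConjecture W 2`**.
[cite: Kato2004Asterisque, Thm. 17.4 (1)(2) (p. 273)] [cite: GreenbergLNM1716, Thm. 4.1 (p. 102), §4 Lemma 4.3 (p. 103), Conj. 1.11] [cite: Miller2011LMS, Def. 1.1] -/
theorem mazurMainConjecture_two_of_bsdp_of_natCard_selmerLayer_succ_mul_lt_mul
    (h17 : ∀ [NeZero (W.conductorNorm ℤ)] (f : CuspForm (Gamma0 (W.conductorNorm ℤ)) 2), kato_divisibility_allPrimes W 2 (f := f))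
    (hGr : Greenberg1999.thm41_charValue_rankZero_anyPrime)
    (hper : realPeriodRat_eq_unit_mul_plusPeriod_two) (hmod : nonempty_modularParametrizationData)
    (hGZK : rank_eq_analyticRank_of_analyticRank_le_one) (hord : IsOrdinaryAt W 2)
    (ht : ∀ x : ℚ, ¬ HasRationalTwoTorsionX W x) (hr : W.analyticRank = 0) (hbsd : BSDp W 2)
    (hcert : ∀ (κ : ZpExtension ℚ 2) (γ : Field.absoluteGaloisGroup ℚ), κ.IsCyclotomic → κ.IsTopGenerator γ → IsCyclotomicVariable 2 γ →
      ∃ n : ℕ, 0 < Nat.card ↥(W.selmerLayer κ (n + 1)) * Nat.card (W.KerG κ (n + 1)) ∧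
        Nat.card ↥(W.selmerLayer κ (n + 1)) * Nat.card (W.KerG κ (n + 1)) * Nat.card (W.layerToInfty κ n).ker <
          2 ^ (2 ^ n) * (Nat.card ↥(W.selmerLayer κ n) * Nat.card (W.KerG κ n))) :
    MazurMainConjecture W 2 := by
  refine AlignedTransportAtTwoSeed.mazurMainConjecture_two_of_bsdp_of_mu_eq_zero W h17 hGr hper hmod hGZK hord ht hr hbsd ?_
  intro κ γ hκ hγ hγ' D hD
  haveI : Module.Finite (IwasawaAlgebra 2) D.X := D.module_finite_holds hγ
  obtain ⟨n, hpos, hlt⟩ := hcert κ γ hκ hγ hγ'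
  have hlt' : Nat.card ↥(W.selmerLayer κ (n + 1)) * Nat.card (W.KerG κ (n + 1)) * Nat.card (W.layerToInfty κ n).ker <
      2 ^ (2 ^ n * (2 - 1)) * (Nat.card ↥(W.selmerLayer κ n) * Nat.card (W.KerG κ n)) := by
    rw [show (2:ℕ) - 1 = 1 from rfl, mul_one]; exact hlt
  exact mu_eq_zero_of_natCard_selmerLayer_succ_mul_lt_mul W κ hγ D hD hpos hlt'

/-- ★★ **C2 BY NAME FROM PRINT + THE TWO-LAYER FINITE-LEVEL CERTIFICATE ON THE SEED CELL.** CONDITIONAL (credits nothing; the certificate is not computed here).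
[cite: Kato2004Asterisque, Thm. 17.4 (1)(2) (p. 273)] [cite: GreenbergLNM1716, Thm. 4.1 (p. 102), §4 Lemma 4.3 (p. 103), §1 Conj. 1.11 (p. 58)] -/
theorem mainConjectureOfRankZeroBSDAtTwo_of_natCard_selmerLayer_succ_mul_lt_mul
    (h17 : ∀ (V : WeierstrassCurve ℚ) [V.IsElliptic] [V.IsGloballyMinimal] [NeZero (V.conductorNorm ℤ)]
      (f : CuspForm (Gamma0 (V.conductorNorm ℤ)) 2), kato_divisibility_allPrimes V 2 (f := f))
    (hGr : Greenberg1999.thm41_charValue_rankZero_anyPrime)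
    (hper : realPeriodRat_eq_unit_mul_plusPeriod_two) (hmod : nonempty_modularParametrizationData)
    (hGZK : rank_eq_analyticRank_of_analyticRank_le_one)
    (hcert : ∀ (W : WeierstrassCurve ℚ) [W.IsElliptic] [W.IsGloballyMinimal], ¬ W.HasCM →
      IsOrdinaryAt W 2 → (∀ x : ℚ, ¬ HasRationalTwoTorsionX W x) → ¬ IsSquare W.Δ → W.analyticRank = 0 →
      ∀ (κ : ZpExtension ℚ 2) (γ : Field.absoluteGaloisGroup ℚ), κ.IsCyclotomic → κ.IsTopGenerator γ → IsCyclotomicVariable 2 γ →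
        ∃ n : ℕ, 0 < Nat.card ↥(W.selmerLayer κ (n + 1)) * Nat.card (W.KerG κ (n + 1)) ∧
          Nat.card ↥(W.selmerLayer κ (n + 1)) * Nat.card (W.KerG κ (n + 1)) * Nat.card (W.layerToInfty κ n).ker <
            2 ^ (2 ^ n) * (Nat.card ↥(W.selmerLayer κ n) * Nat.card (W.KerG κ n))) :
    MainConjectureOfRankZeroBSDAtTwo := by
  intro W _ _ hcm hord ht hsq hr _hμan hbsd
  exact mazurMainConjecture_two_of_bsdp_of_natCard_selmerLayer_succ_mul_lt_mul W (fun f => h17 W f) hGr hper hmod hGZK hord ht hr hbsd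
    (hcert W hcm hord ht hsq hr)

end Finite

end Summit.BirchSwinnertonDyer.BirchSwinnertonDyer.Theorems.AlignedTransportAtTwoHalfDescentLayerIndexGrowthSeed

end
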